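import Summits.CriticalPhenomena.PercolationContinuityZ3.Theorems.SahiMasterFamilyFInequalityFreeCoordinates
import Summits.CriticalPhenomena.PercolationContinuityZ3.Theorems.SahiMasterFamilyFInequalityTwoCoordinates
import Summits.CriticalPhenomena.PercolationContinuityZ3.Theorems.PercNearOneGluingNoHeavyLowerTailSahiCombJunta

/-!
# The junta reduction for the `F`-inequality (dimension-free), and `F ≥ 0` for every third event on at most two coordinates

Unit `prim-master-conj` (crux anchor stmt-CriticalPhenomena-4575, helper work), gen 22; memo
`run/shared/lean/prim/prim-l12/prim-master-conj/POINTWISE.md` §22–§23.  Companion of gen 21's `…FInequalityFreeCoordinates`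
(one free coordinate) and `…FInequalityTwoCoordinates` (the two kernel classes on two coordinates).

Recall (gen 20, memo §21), for events `A, B, G ⊆ 2^ι` and a product measure `μ = μ_p`,
  `F(A,B;G) := (1 + μG)·μ(A∩B∩G) − μG·μ(A∩B) − μ(A∩G)·μ(B∩G)`,
conjectured `≥ 0` whenever `A, B, G` are increasing (it implies `MD_3` on the D0 core, `sahiE_three_ge_sq_minor_of_F_nonneg`).

* `fIneq_nonneg_of_determinedBy_aux`, **`fIneq_nonneg_of_determinedBy`** — THE JUNTA REDUCTION (memo §22.0, paper step (ii), now a kernel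
  fact in full): if the third event `G` (not necessarily increasing) is determined by a finite set `S` of coordinates and `F(A',B';G) ≥ 0` for
  all INCREASING `S`-determined `A', B'`, then `F(A,B;G) ≥ 0` for ALL increasing `A, B` of `2^ι`.  Proof: induction on a finset `T` with `A, B`
  determined by `S ∪ T`, conditioning on one coordinate of `T ∖ S` at a time by gen 21's one-step lemma `fIneq_nonneg_of_free_of_sections`
  (the sections are increasing, `(S ∪ T ∖ {e})`-determined, and `G` is `e`-free).
* `upperSet_determinedBy_pair_cases` — an increasing event determined by `{a, b}` is one of `∅, univ, {a∈ω}, {b∈ω}, {a∈ω}∩{b∈ω}, {a∈ω}∪{b∈ω}`.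
* **`fIneq_nonneg_of_determinedBy_pair`** — `F(A,B;G) ≥ 0` for all increasing `A, B` whenever the increasing event `G` is determined by at most two
  coordinates `{a, b}` (`a = b` allowed): the six cases are `F = 0`, Harris, gen 21's `fIneq_nonneg_of_coordinate`,
  `fIneq_nonneg_of_two_coordinates_inter`, `fIneq_nonneg_of_two_coordinates`.  This completes ALL `≤ 2`-juntas `G` in the kernel.
* `sahiE_three_ge_sq_minor_of_third_determinedBy_pair` — the D0-core consequence: `MD_3` at `(U,e)` is unconditional whenever the `e`-free third
  member is determined by at most two coordinates.
HONEST FRAMING: the reduction is elementary; on paper it combines with the exhaustive Bernstein censuses (`k ≤ 6`) to give `F ≥ 0` for every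
`≤ 6`-junta `G` (computer-assisted, NOT a kernel fact); `F ≥ 0` in general remains OPEN. [this work]
-/

noncomputable section

open scoped Classical

namespace Summit.CriticalPhenomena.PercolationContinuityZ3.Theorems

open Finset Function
open Literature.Combinatorics.Sahi2008
open Literature.Probability.Percolation (DeterminedBy determinedBy_iff)
open Literature.Probability.Percolation.DecisionTree (ind)

namespace Pointwise

variable {ι : Type} [Fintype ι]

/-! ### 1. The junta reduction -/

/-- **Junta reduction, inductive form.**  If `G` is determined by `S` and `F(A',B';G) ≥ 0` for all increasing `S`-determined `A', B'`, then
`F(A,B;G) ≥ 0` for all increasing `A, B` determined by `S ∪ T`, for every finset `T` (induction on `T`, one free coordinate at a time via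
`fIneq_nonneg_of_free_of_sections`). [this work] -/
theorem fIneq_nonneg_of_determinedBy_aux (p : ι → unitInterval) (S : Finset ι) {G : Set (Set ι)} (hGd : DeterminedBy G (↑S : Set ι))
    (hbase : ∀ A' B' : Set (Set ι), IsUpperSet A' → IsUpperSet B' → DeterminedBy A' (↑S : Set ι) → DeterminedBy B' (↑S : Set ι) →
      0 ≤ (1 + ex (bernoulliWeight p) (ind G)) * ex (bernoulliWeight p) (ind (A' ∩ B' ∩ G))
        - ex (bernoulliWeight p) (ind G) * ex (bernoulliWeight p) (ind (A' ∩ B'))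
        - ex (bernoulliWeight p) (ind (A' ∩ G)) * ex (bernoulliWeight p) (ind (B' ∩ G))) :
    ∀ (T : Finset ι) (A B : Set (Set ι)), IsUpperSet A → IsUpperSet B → DeterminedBy A (↑(S ∪ T) : Set ι) →
      DeterminedBy B (↑(S ∪ T) : Set ι) →
      0 ≤ (1 + ex (bernoulliWeight p) (ind G)) * ex (bernoulliWeight p) (ind (A ∩ B ∩ G))
        - ex (bernoulliWeight p) (ind G) * ex (bernoulliWeight p) (ind (A ∩ B))
        - ex (bernoulliWeight p) (ind (A ∩ G)) * ex (bernoulliWeight p) (ind (B ∩ G)) := by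
  intro T
  induction T using Finset.induction_on with
  | empty =>
    intro A B hA hB hAd hBd
    rw [Finset.union_empty] at hAd hBd
    exact hbase A B hA hB hAd hBd
  | insert e T heT ih =>
    intro A B hA hB hAd hBd
    by_cases heS : e ∈ S
    · have hE : S ∪ insert e T = S ∪ T := by
        ext x; simp only [Finset.mem_union, Finset.mem_insert]
        constructor
        · rintro (hx | rfl | hx)
          · exact Or.inl hx
          · exact Or.inl heS
          · exact Or.inr hx
        · rintro (hx | hx)
          · exact Or.inl hx
          · exact Or.inr (Or.inr hx)
      rw [hE] at hAd hBd
      exact ih A B hA hB hAd hBd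
    · -- condition on the coordinate `e ∉ S`, which `G` ignores
      have heST : e ∉ S ∪ T := by simp [heS, heT]
      have hE : (S ∪ insert e T).erase e = S ∪ T := by
        rw [Finset.union_insert, Finset.erase_insert heST]
      have hG0 : secAt e false G = G := SahiCombJunta.secAt_eq_self_of_determinedBy hGd (by simpa using heS) false
      have hG1 : secAt e true G = G := SahiCombJunta.secAt_eq_self_of_determinedBy hGd (by simpa using heS) true
      have hG : secAt e true G = secAt e false G := by rw [hG0, hG1]
      have hsecA : ∀ b : Bool, DeterminedBy (secAt e b A) (↑(S ∪ T) : Set ι) := fun b => by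
        have h := determinedBy_secAt e b hAd
        rwa [hE] at h
      have hsecB : ∀ b : Bool, DeterminedBy (secAt e b B) (↑(S ∪ T) : Set ι) := fun b => by
        have h := determinedBy_secAt e b hBd
        rwa [hE] at h
      have hrec : ∀ b : Bool,
          0 ≤ (1 + ex (bernoulliWeight p) (ind (secAt e false G)))
              * ex (bernoulliWeight p) (ind (secAt e b A ∩ secAt e b B ∩ secAt e false G))
            - ex (bernoulliWeight p) (ind (secAt e false G)) * ex (bernoulliWeight p) (ind (secAt e b A ∩ secAt e b B))
            - ex (bernoulliWeight p) (ind (secAt e b A ∩ secAt e false G))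
              * ex (bernoulliWeight p) (ind (secAt e b B ∩ secAt e false G)) := fun b => by
        rw [hG0]
        exact ih (secAt e b A) (secAt e b B) (isUpperSet_secAt e b hA) (isUpperSet_secAt e b hB) (hsecA b) (hsecB b)
      exact fIneq_nonneg_of_free_of_sections p e A B G hG hA hB (hrec false) (hrec true)

/-- **THE JUNTA REDUCTION for `F` (memo §22.0 (ii)).**  Let the third event `G ⊆ 2^ι` be determined by a finite set `S` of coordinates.
If `F(A',B';G) ≥ 0` for all increasing `S`-determined events `A', B'`, then `F(A,B;G) ≥ 0` for ALL increasing events `A, B` of `2^ι`.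
(`G` need not be increasing; on paper, combined with the exhaustive Bernstein censuses on `{0,1}^k, k ≤ 6`, this gives `F ≥ 0` for every
`≤ 6`-junta `G`.) [this work] -/
theorem fIneq_nonneg_of_determinedBy (p : ι → unitInterval) (S : Finset ι) {G : Set (Set ι)} (hGd : DeterminedBy G (↑S : Set ι))
    (hbase : ∀ A' B' : Set (Set ι), IsUpperSet A' → IsUpperSet B' → DeterminedBy A' (↑S : Set ι) → DeterminedBy B' (↑S : Set ι) →
      0 ≤ (1 + ex (bernoulliWeight p) (ind G)) * ex (bernoulliWeight p) (ind (A' ∩ B' ∩ G))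
        - ex (bernoulliWeight p) (ind G) * ex (bernoulliWeight p) (ind (A' ∩ B'))
        - ex (bernoulliWeight p) (ind (A' ∩ G)) * ex (bernoulliWeight p) (ind (B' ∩ G)))
    {A B : Set (Set ι)} (hA : IsUpperSet A) (hB : IsUpperSet B) :
    0 ≤ (1 + ex (bernoulliWeight p) (ind G)) * ex (bernoulliWeight p) (ind (A ∩ B ∩ G))
        - ex (bernoulliWeight p) (ind G) * ex (bernoulliWeight p) (ind (A ∩ B))
        - ex (bernoulliWeight p) (ind (A ∩ G)) * ex (bernoulliWeight p) (ind (B ∩ G)) := by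
  have hAd : DeterminedBy A (↑(S ∪ Finset.univ) : Set ι) := by
    rw [determinedBy_iff]; intro ω ω' h
    have : ω = ω' := by simpa using h
    rw [this]
  have hBd : DeterminedBy B (↑(S ∪ Finset.univ) : Set ι) := by
    rw [determinedBy_iff]; intro ω ω' h
    have : ω = ω' := by simpa using h
    rw [this]
  exact fIneq_nonneg_of_determinedBy_aux p S hGd hbase Finset.univ A B hA hB hAd hBd

/-! ### 2. Increasing events on at most two coordinates -/

omit [Fintype ι] in
/-- **Classification**: an increasing event determined by `{a, b}` is `∅`, `univ`, `{a∈ω}`, `{b∈ω}`, `{a∈ω}∩{b∈ω}` or `{a∈ω}∪{b∈ω}`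
(`a = b` allowed). [folklore] -/
theorem upperSet_determinedBy_pair_cases {G : Set (Set ι)} (hG : IsUpperSet G) {a b : ι} (hGd : DeterminedBy G ({a, b} : Set ι)) :
    G = ∅ ∨ G = Set.univ ∨ G = {ω : Set ι | a ∈ ω} ∨ G = {ω : Set ι | b ∈ ω} ∨
      G = {ω : Set ι | a ∈ ω} ∩ {ω : Set ι | b ∈ ω} ∨ G = {ω : Set ι | a ∈ ω} ∪ {ω : Set ι | b ∈ ω} := by
  rw [determinedBy_iff] at hGd
  -- membership is decided by the trace on `{a, b}`
  have key : ∀ ω : Set ι, ω ∈ G ↔ ω ∩ {a, b} ∈ G := fun ω =>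
    hGd ω (ω ∩ {a, b}) (by rw [Set.inter_assoc, Set.inter_self])
  by_cases h0 : (∅ : Set ι) ∈ G
  · -- `G = univ`
    refine Or.inr (Or.inl ?_)
    exact Set.eq_univ_of_forall fun ω => hG (Set.empty_subset ω) h0
  by_cases ha : ({a} : Set ι) ∈ G
  · by_cases hb : ({b} : Set ι) ∈ G
    · -- `G = {a∈ω} ∪ {b∈ω}`
      refine Or.inr (Or.inr (Or.inr (Or.inr (Or.inr ?_))))
      ext ω
      simp only [Set.mem_union, Set.mem_setOf_eq]
      constructor
      · intro hω
        by_contra hne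
        push Not at hne
        have : ω ∩ {a, b} = ∅ := by
          ext x; simp only [Set.mem_inter_iff, Set.mem_insert_iff, Set.mem_singleton_iff, Set.mem_empty_iff_false,
            iff_false, not_and]
          rintro hx (rfl | rfl)
          · exact hne.1 hx
          · exact hne.2 hx
        exact h0 (this ▸ (key ω).1 hω)
      · rintro (hω | hω)
        · exact hG (Set.singleton_subset_iff.2 hω) ha
        · exact hG (Set.singleton_subset_iff.2 hω) hb
    · -- `G = {a∈ω}`
      refine Or.inr (Or.inr (Or.inl ?_))
      ext ω
      simp only [Set.mem_setOf_eq]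
      constructor
      · intro hω
        by_contra hna
        have hsub : ω ∩ {a, b} ⊆ {b} := by
          intro x hx
          simp only [Set.mem_inter_iff, Set.mem_insert_iff, Set.mem_singleton_iff] at hx
          rcases hx with ⟨hx, rfl | rfl⟩
          · exact absurd hx hna
          · rfl
        exact hb (hG hsub ((key ω).1 hω))
      · intro hω
        exact hG (Set.singleton_subset_iff.2 hω) ha
  · by_cases hb : ({b} : Set ι) ∈ G
    · -- `G = {b∈ω}`
      refine Or.inr (Or.inr (Or.inr (Or.inl ?_)))
      ext ω
      simp only [Set.mem_setOf_eq]
      constructor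
      · intro hω
        by_contra hnb
        have hsub : ω ∩ {a, b} ⊆ {a} := by
          intro x hx
          simp only [Set.mem_inter_iff, Set.mem_insert_iff, Set.mem_singleton_iff] at hx
          rcases hx with ⟨hx, rfl | rfl⟩
          · rfl
          · exact absurd hx hnb
        exact ha (hG hsub ((key ω).1 hω))
      · intro hω
        exact hG (Set.singleton_subset_iff.2 hω) hb
    · by_cases hab : ({a, b} : Set ι) ∈ G
      · -- `G = {a∈ω} ∩ {b∈ω}`
        refine Or.inr (Or.inr (Or.inr (Or.inr (Or.inl ?_))))
        ext ω
        simp only [Set.mem_inter_iff, Set.mem_setOf_eq]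
        constructor
        · intro hω
          have hω' := (key ω).1 hω
          by_contra hne
          rw [not_and_or] at hne
          rcases hne with hna | hnb
          · have hsub : ω ∩ {a, b} ⊆ {b} := by
              intro x hx
              simp only [Set.mem_inter_iff, Set.mem_insert_iff, Set.mem_singleton_iff] at hx
              rcases hx with ⟨hx, rfl | rfl⟩
              · exact absurd hx hna
              · rfl
            exact hb (hG hsub hω')
          · have hsub : ω ∩ {a, b} ⊆ {a} := by
              intro x hx
              simp only [Set.mem_inter_iff, Set.mem_insert_iff, Set.mem_singleton_iff] at hx
              rcases hx with ⟨hx, rfl | rfl⟩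
              · rfl
              · exact absurd hx hnb
            exact ha (hG hsub hω')
        · rintro ⟨hωa, hωb⟩
          exact hG (Set.insert_subset_iff.2 ⟨hωa, Set.singleton_subset_iff.2 hωb⟩) hab
      · -- `G = ∅`
        refine Or.inl ?_
        ext ω
        simp only [Set.mem_empty_iff_false, iff_false]
        intro hω
        exact hab (hG Set.inter_subset_right ((key ω).1 hω))

/-- `F(A,B;∅) = 0`. [this work] -/
theorem fIneq_empty (p : ι → unitInterval) (A B : Set (Set ι)) :
    (1 + ex (bernoulliWeight p) (ind (∅ : Set (Set ι)))) * ex (bernoulliWeight p) (ind (A ∩ B ∩ ∅))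
        - ex (bernoulliWeight p) (ind (∅ : Set (Set ι))) * ex (bernoulliWeight p) (ind (A ∩ B))
        - ex (bernoulliWeight p) (ind (A ∩ ∅)) * ex (bernoulliWeight p) (ind (B ∩ ∅)) = 0 := by
  simp only [Set.inter_empty, ex_ind_empty]
  ring

/-- `F(A,B;univ) = Cov(A,B) ≥ 0` for increasing `A, B` (Harris). [this work] -/
theorem fIneq_nonneg_univ (p : ι → unitInterval) {A B : Set (Set ι)} (hA : IsUpperSet A) (hB : IsUpperSet B) :
    0 ≤ (1 + ex (bernoulliWeight p) (ind (Set.univ : Set (Set ι)))) * ex (bernoulliWeight p) (ind (A ∩ B ∩ Set.univ))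
        - ex (bernoulliWeight p) (ind (Set.univ : Set (Set ι))) * ex (bernoulliWeight p) (ind (A ∩ B))
        - ex (bernoulliWeight p) (ind (A ∩ Set.univ)) * ex (bernoulliWeight p) (ind (B ∩ Set.univ)) := by
  have h1 : ex (bernoulliWeight p) (ind (Set.univ : Set (Set ι))) = 1 := by
    rw [ind_univ_eq_one]; exact ex_one (sum_bernoulliWeight p)
  simp only [Set.inter_univ, h1]
  have hH := cov_ind_nonneg p hA hB
  nlinarith [hH]

/-- **`F(A,B;G) ≥ 0` for all increasing `A, B` whenever the increasing third event `G` is determined by at most two coordinates `{a, b}`**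
(`a = b` allowed) — all `≤ 2`-juntas are in the kernel class. [this work] -/
theorem fIneq_nonneg_of_determinedBy_pair (p : ι → unitInterval) {G : Set (Set ι)} (hG : IsUpperSet G) {a b : ι}
    (hGd : DeterminedBy G ({a, b} : Set ι)) {A B : Set (Set ι)} (hA : IsUpperSet A) (hB : IsUpperSet B) :
    0 ≤ (1 + ex (bernoulliWeight p) (ind G)) * ex (bernoulliWeight p) (ind (A ∩ B ∩ G))
        - ex (bernoulliWeight p) (ind G) * ex (bernoulliWeight p) (ind (A ∩ B))
        - ex (bernoulliWeight p) (ind (A ∩ G)) * ex (bernoulliWeight p) (ind (B ∩ G)) := by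
  rcases upperSet_determinedBy_pair_cases hG hGd with h | h | h | h | h | h
  · rw [h, fIneq_empty]
  · rw [h]; exact fIneq_nonneg_univ p hA hB
  · rw [h]; exact fIneq_nonneg_of_coordinate p a hA hB
  · rw [h]; exact fIneq_nonneg_of_coordinate p b hA hB
  · by_cases hab : a = b
    · subst hab
      rw [Set.inter_self] at h
      rw [h]; exact fIneq_nonneg_of_coordinate p a hA hB
    · rw [h]; exact fIneq_nonneg_of_two_coordinates_inter p hab hA hB
  · by_cases hab : a = b
    · subst hab
      rw [Set.union_self] at h
      rw [h]; exact fIneq_nonneg_of_coordinate p a hA hB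
    · rw [h]; exact fIneq_nonneg_of_two_coordinates p hab hA hB

/-- Finset form: `G` increasing and determined by a finset with at most two elements. [this work] -/
theorem fIneq_nonneg_of_determinedBy_card_le_two (p : ι → unitInterval) {G : Set (Set ι)} (hG : IsUpperSet G) {S : Finset ι}
    (hS : S.card ≤ 2) (hSne : S.Nonempty) (hGd : DeterminedBy G (↑S : Set ι)) {A B : Set (Set ι)} (hA : IsUpperSet A)
    (hB : IsUpperSet B) :
    0 ≤ (1 + ex (bernoulliWeight p) (ind G)) * ex (bernoulliWeight p) (ind (A ∩ B ∩ G))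
        - ex (bernoulliWeight p) (ind G) * ex (bernoulliWeight p) (ind (A ∩ B))
        - ex (bernoulliWeight p) (ind (A ∩ G)) * ex (bernoulliWeight p) (ind (B ∩ G)) := by
  obtain ⟨a, ha⟩ := hSne
  -- `S ⊆ {a, b}` for some `b`
  have hex : ∃ b : ι, (↑S : Set ι) ⊆ {a, b} := by
    by_cases h1 : S.card ≤ 1
    · refine ⟨a, fun x hx => ?_⟩
      have := Finset.card_le_one.1 h1 x (Finset.mem_coe.1 hx) a ha
      simp [this]
    · have h2 : S.card = 2 := by omega
      obtain ⟨x, y, hxy, hS2⟩ := Finset.card_eq_two.1 h2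
      rcases Finset.mem_insert.1 (hS2 ▸ ha) with rfl | ha'
      · exact ⟨y, by rw [hS2]; simp⟩
      · have : a = y := Finset.mem_singleton.1 ha'
        subst this
        exact ⟨x, by rw [hS2]; intro z hz; simp only [Finset.coe_insert, Finset.coe_singleton, Set.mem_insert_iff,
          Set.mem_singleton_iff] at hz ⊢; tauto⟩
  obtain ⟨b, hb⟩ := hex
  exact fIneq_nonneg_of_determinedBy_pair p hG (hGd.mono hb) hA hB

/-! ### 3. The D0-core consequence -/

/-- **MD_3 on the D0 core when the third member is determined by at most two coordinates.**  Under the hypotheses of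
`sahiE_three_ge_sq_minor_of_F_nonneg` (increasing triple `U`, `e`-free third member `U_2` containing both `0`-sections `X = U_0^{e←0}`,
`Y = U_1^{e←0}`, which are independent), if `G = U_2^{e←0}` is determined by `{a, b}` then
`(1−p_e)²E_3(U^{e←0}) + p_e²E_3(U^{e←1}) ≤ E_3(U)` unconditionally. [this work] -/
theorem sahiE_three_ge_sq_minor_of_third_determinedBy_pair (p : ι → unitInterval) (e : ι) {a b : ι} (U : Fin 3 → Set (Set ι))
    (hU : ∀ j, IsUpperSet (U j)) (hG : secAt e true (U 2) = secAt e false (U 2))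
    (hXG : secAt e false (U 0) ⊆ secAt e false (U 2)) (hYG : secAt e false (U 1) ⊆ secAt e false (U 2))
    (hXY : ex (bernoulliWeight p) (ind (secAt e false (U 0) ∩ secAt e false (U 1)))
      = ex (bernoulliWeight p) (ind (secAt e false (U 0))) * ex (bernoulliWeight p) (ind (secAt e false (U 1))))
    (hGd : DeterminedBy (secAt e false (U 2)) ({a, b} : Set ι)) :
    (1 - (p e : ℝ)) ^ 2 * sahiE (bernoulliWeight p) 3 (fun j => ind (secAt e false (U j)))
        + (p e : ℝ) ^ 2 * sahiE (bernoulliWeight p) 3 (fun j => ind (secAt e true (U j)))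
      ≤ sahiE (bernoulliWeight p) 3 (fun j => ind (U j)) := by
  refine sahiE_three_ge_sq_minor_of_F_nonneg p e U hU hG hXG hYG hXY ?_
  exact fIneq_nonneg_of_determinedBy_pair p (isUpperSet_secAt e false (hU 2)) hGd
    (isUpperSet_secAt e true (hU 0)) (isUpperSet_secAt e true (hU 1))

end Pointwise

end Summit.CriticalPhenomena.PercolationContinuityZ3.Theorems
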